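import Literature.MathematicalPhysics.QuantumLattice.HubbardNNNHoppingWindowCertificateWardD4TL
import HarnessLib

/-!
# The SU(2)-Ward slot of the `M3x2EdgeSplit.LowerEdge_ge_m83o100` skeleton of record: `stub_wardWindowSound` DISCHARGED
(−83/100 twin of `Theorems/M3PrimeEdgeSplitLowerEdge_ge_m4o5WardWindowSound`; same statement text, own namespace so that
the two `--supports` landings are independent)

HONEST FRAMING: first certified bounds; not a superconductivity verdict. NO number is proved here and no crux or
summit statement: this file discharges the SOUNDNESS stub `stub_wardWindowSound : WardD4WindowSound` (stub 1 of the
registered crux-plan skeletons `fo_dual_rounding` on items stmt-Ventures-21721 `M3PrimeEdgeSplit.LowerEdge_ge_m4o5` and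
stmt-Ventures-22024 `M3x2EdgeSplit.LowerEdge_ge_m83o100`; statement text = team lb-sym's `wardk` W1∘W2∘W3, pen
hub-lb-sym-plan-2) by the Literature chain landed by hub-lb-sym-eng-3:
`HubbardTorusGenericSectorCertificate` (W1, generic-sector torus engine) →
`HubbardNNNHoppingWindowCertificateWardD4` (W2, Ward × `D₄` certificate read in the full `2n`-particle sector) →
`HubbardTTPrimeTorusFamilyTransport` (W3, torus family ⇒ thermodynamic limit) →
`HubbardNNNHoppingWindowCertificateWardD4TL.energyDensityTT'_ge_of_wardD4_window_certificate`.
What remains of those skeletons afterwards is the slack reader (`stub_slackAbsorb`, proved by hub-lb-sym-ref-1) and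
the VALUE stubs (`stub_nearCert_…`: a certificate ≥ −4/5 does not exist today; −83/100 is met by value by #529 but its
kernel replay is XL). A certified bound is a number with a certificate; nothing here predicts superconductivity.
-/

noncomputable section

namespace Summit.Ventures.CertifiedManyBodySolver.Theorems.WardSlotM83

open Matrix Finset
open Literature.MathematicalPhysics.QuantumLattice
open Literature.MathematicalPhysics.QuantumLattice.HubbardWave0
open Literature.MathematicalPhysics.QuantumLattice.ThermodynamicLimit
open Literature.Probability.LatticeModels
open Literature.MathematicalPhysics.QuantumManyBody.StateRelaxation
open scoped ComplexOrder BigOperators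

/-- **VERBATIM COPY of `WardK.WardD4Identity` (Cruxes/LowerEdge_ge_m4o5/Lines/wardk.lean, sym-plan-2 = pen of
record for the Ward slot).** The `SU(2)`-Ward × affine-`D₄` window identity in `𝔄_{Λ'}` for the `t–t'` Hubbard
interaction at target density `n`: ONE multiplier `μ` on the total site density and the two Ward null families
`Σ_r (S⁺_{Λ'} X_r − X_r S⁺_{Λ'})`, `Σ_r (S⁻_{Λ'} X'_r − X'_r S⁻_{Λ'})` next to the null terms of
`groundEnergy_hubbardTorusTT'_div_ge_of_window_certificate_d4`. (Copied VERBATIM — rfl-equal — from the registered skeletons of record `Cruxes/LowerEdge_ge_m4o5/Lines/fo_dual_rounding.lean`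
§1 (sha 94f99bf03038) = `Cruxes/LowerEdge_ge_m83o100/Lines/fo_dual_rounding.lean` §1 (sha 74e9a7f66a0c) = `Lines/wardk.lean`, because Cruxes
workfiles are not importable modules; the gate's stub check matches name + signature text.) -/
def WardD4Identity (t t' U n : ℝ) {Λ Λ' : Finset (Site 2)} (hΛ : Λ ⊆ Λ')
    (h0 : thicken ({0} : Finset (Site 2)) 1 ⊆ Λ') (hz : (0 : Site 2) ∈ Λ') (μ : ℝ)
    {m : Type} [Fintype m] [DecidableEq m] (Λm : Matrix m m ℂ) (O : m → FermionOp Λ')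
    {κ : Type} (s : Finset κ) (B : κ → FermionOp Λ)
    {ι : Type} (tt : Finset ι) (γ : ι → DihedralGroup 4) (wv : ι → Site 2)
    (hsh : ∀ l, d4ShiftSet (γ l) (wv l) Λ ⊆ Λ') (Y : ι → FermionOp Λ)
    {ρ : Type} (u : Finset ρ) (b : ρ → ℂ) (cw : ρ → List (Orb (PolySite Λ') × Bool))
    {θ : Type} (wp : Finset θ) (Xp : θ → FermionOp Λ')
    {θ' : Type} (wm : Finset θ') (Xm : θ' → FermionOp Λ')
    {δ : Type} (ah : Finset δ) (dc : δ → ℝ) (V : δ → FermionOp Λ')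
    {κ'' : Type} (w : Finset κ'') (a : κ'' → ℂ) (word : κ'' → List (Orb (PolySite Λ') × Bool))
    (c : ℝ) : Prop :=
  fermionEmbed (PolySite.incl h0) ((hubbardTTPrimeFermionInteraction t t' U).meanEnergyObs 1) -
      (c : ℂ) • (1 : FermionOp Λ') -
      ((μ : ℝ) : ℂ) • (nAt 0 hz 0 + nAt 0 hz 1 - ((n : ℝ) : ℂ) • (1 : FermionOp Λ')) =
    gramForm Λm O +
      (∑ k ∈ s, ((hubbardTTPrimeFermionInteraction t t' U).localHamiltonian Λ' * fermionEmbed (PolySite.incl hΛ) (B k) -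
          fermionEmbed (PolySite.incl hΛ) (B k) * (hubbardTTPrimeFermionInteraction t t' U).localHamiltonian Λ') +
        ∑ l ∈ tt, (fermionEmbed (PolySite.incl (hsh l)) (fermionEmbed (PolySite.d4Emb (γ l) (wv l) Λ) (Y l)) -
          fermionEmbed (PolySite.incl hΛ) (Y l)) +
        ∑ j ∈ u, b j • ladderWord (cw j) +
        ∑ r ∈ wp, ((spinPlus : FermionOp Λ') * Xp r - Xp r * (spinPlus : FermionOp Λ')) +
        ∑ r ∈ wm, ((spinMinus : FermionOp Λ') * Xm r - Xm r * (spinMinus : FermionOp Λ'))) +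
      (∑ m' ∈ ah, ((dc m' : ℝ) : ℂ) • ((V m')ᴴ - V m') + ∑ k ∈ w, a k • ladderWord (word k))

/-- **VERBATIM COPY of `WardK.WardD4WindowSound` (wardk W3 target = W1∘W2∘W3): Ward × `D₄` window certificate ⇒
`c − Σₖ ‖aₖ‖ ≤ energyDensityTT' t t' U n`** (`0 ≤ U`, `0 ≤ n < 2`, `thicken Λ 1 ⊆ Λ'`), Gram multiplier `Λm`
EXACTLY PSD, generators `O : m → FermionOp Λ'` arbitrary. -/
def WardD4WindowSound : Prop :=
  ∀ (t t' U : ℝ), 0 ≤ U → ∀ (n : ℝ), 0 ≤ n → n < 2 →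
  ∀ (Λ Λ' : Finset (Site 2)) (hΛ : Λ ⊆ Λ') (_h8 : thicken Λ 1 ⊆ Λ')
    (h0 : thicken ({0} : Finset (Site 2)) 1 ⊆ Λ') (hz : (0 : Site 2) ∈ Λ')
    (μ : ℝ)
    (m : Type) (_ : Fintype m) (_ : DecidableEq m) (Λm : Matrix m m ℂ) (_hΛm : Λm.PosSemidef)
    (O : m → FermionOp Λ')
    (κ : Type) (s : Finset κ) (B : κ → FermionOp Λ)
    (ι : Type) (tt : Finset ι) (γ : ι → DihedralGroup 4) (wv : ι → Site 2)
    (hsh : ∀ l, d4ShiftSet (γ l) (wv l) Λ ⊆ Λ') (Y : ι → FermionOp Λ)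
    (ρ : Type) (u : Finset ρ) (b : ρ → ℂ) (cw : ρ → List (Orb (PolySite Λ') × Bool))
    (_hcw : ∀ j ∈ u, ladderCharge (cw j) ≠ 0 ∨ ladderSpinCharge (cw j) ≠ 0)
    (θ : Type) (wp : Finset θ) (Xp : θ → FermionOp Λ')
    (θ' : Type) (wm : Finset θ') (Xm : θ' → FermionOp Λ')
    (δ : Type) (ah : Finset δ) (dc : δ → ℝ) (V : δ → FermionOp Λ')
    (κ'' : Type) (w : Finset κ'') (a : κ'' → ℂ) (word : κ'' → List (Orb (PolySite Λ') × Bool))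
    (c : ℝ),
    WardD4Identity t t' U n hΛ h0 hz μ Λm O s B tt γ wv hsh Y u b cw wp Xp wm Xm ah dc V w a word c →
    c - ∑ k ∈ w, ‖a k‖ ≤ energyDensityTT' t t' U n

/-- **Stub 1 of the skeletons of record, DISCHARGED**: every SU(2)-Ward × affine-`D₄` window certificate for the
`t–t'` Hubbard model (`0 ≤ U`, `0 ≤ n < 2`) proves `c − Σₖ ‖aₖ‖ ≤ energyDensityTT' t t' U n` — the soundness of
Han's translation-invariant bootstrap WITH the SU(2) Ward rows `ω([S^±, X]) = 0` (the constraint set of the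
symmetry-reduced `t–t'` programs of record). Proof term = the Literature theorem
`energyDensityTT'_ge_of_wardD4_window_certificate` (binder list identical). [cite: Han2020Bootstrap, §3] -/
theorem stub_wardWindowSound : WardD4WindowSound :=
  energyDensityTT'_ge_of_wardD4_window_certificate

end Summit.Ventures.CertifiedManyBodySolver.Theorems.WardSlotM83

end
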